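import Mathlib
import HarnessLib
import Summits.Ventures.LatticeQCDFlow.Scoring.LogRatioAgreementCLT

/-!
# The POWER of the two-code agreement test: if the two codes estimate DIFFERENT values
# (`a_A ≠ a_B`), the studentised difference leaves every window, `P(|Tₙ| ≤ z) → 0` — the
# criterion "within `z·σ_comb`" detects any fixed discrepancy with probability tending to one

HONEST FRAMING: exact (Metropolis-corrected) sampling algorithms for lattice gauge theory;
figures of merit are autocorrelation/cost numbers at stated couplings and volumes; no
continuum-physics claim.

Venture `LatticeQCDFlow` (cell pub-lqcd), topic `Scoring`; FANOUT row 4 (`s0-u1-b`, rung S0-B: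
"A vs B within `1σ_comb`").  `Scoring/AsymptoticCoverage` gave the SIZE of the criterion (nominal
coverage when the two codes agree); this file gives its POWER: two independent codes with
one-code central limit theorems centred at `a_A` and `a_B`, non-negative printed squared standard
errors with `n·V̂ₙ^A → s_A > 0`, `n·V̂ₙ^B → s_B` in probability, code `B` read along any
`mₙ → ∞`.  If `a_A ≠ a_B` then for every `z`,
`(P_A ⊗ P_B)(|Sₙ^A − S_{mₙ}^B| ≤ z·√(V̂ₙ^A + V̂_{mₙ}^B)) → 0`
(**`twoSample_agreement_power`**, stated for the studentised statistic `|T| ≤ z`).  Proof: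
`Sₙ^A − S_{mₙ}^B → a_A − a_B ≠ 0` and `V̂ₙ^A + V̂_{mₙ}^B → 0` in probability (a `√n`-limit law
pins the centring, `Scoring/DeltaMethod`; transport to the product space,
`Scoring/TwoCodeAgreementInProbability`; pairs and continuous maps,
`Scoring/LogRatioAgreementCLT`, `Scoring/MultivariateDeltaMethod`), and the window event is
contained in three small-probability events.  NEW WORK of the cell; no definition; nothing cited
as a fact.

## Content

* `tendstoInMeasure_errorBar_zero` — `n·V̂ₙ → s` in probability ⇒ `V̂ₙ → 0` in probability;
* **`twoSample_agreement_power`**.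

NOT CLAIMED: local alternatives (`a_A − a_B ∼ h/√n`, the power function); rates.
-/

noncomputable section

namespace Summit.Ventures.LatticeQCDFlow.Scoring.CardConsistency

open MeasureTheory ProbabilityTheory Filter
open scoped Topology

section Power

variable {ΩA : Type*} [MeasurableSpace ΩA] {PA : Measure ΩA} [IsProbabilityMeasure PA]
variable {ΩB : Type*} [MeasurableSpace ΩB] {PB : Measure ΩB} [IsProbabilityMeasure PB]
variable {Ω' : Type*} [MeasurableSpace Ω'] {P' : Measure Ω'} [IsProbabilityMeasure P']

/-- `n·V̂ₙ → s` in probability ⇒ `V̂ₙ → 0` in probability. [ours] (pair with the deterministic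
`n⁻¹ → 0`, continuous multiplication) -/
theorem tendstoInMeasure_errorBar_zero {V : ℕ → ΩA → ℝ} {s : ℝ}
    (hV : TendstoInMeasure PA (fun (n : ℕ) ω => (n : ℝ) * V n ω) atTop fun _ => s) :
    TendstoInMeasure PA (fun (n : ℕ) ω => ((n : ℝ) * V n ω) * (n : ℝ)⁻¹) atTop fun _ => 0 := by
  have hinv : TendstoInMeasure PA (fun (n : ℕ) (_ : ΩA) => (n : ℝ)⁻¹) atTop fun _ => (0 : ℝ) :=
    tendstoInMeasure_of_tendsto_ae (fun n => aestronglyMeasurable_const)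
      (Eventually.of_forall fun _ => tendsto_inv_atTop_zero.comp tendsto_natCast_atTop_atTop)
  have hpair := tendstoInMeasure_prodMk hV hinv
  have hφ : ContinuousAt (fun z : ℝ × ℝ => z.1 * z.2) (s, 0) := by fun_prop
  have h := tendstoInMeasure_comp_continuousAt_normed hpair hφ
  exact h.congr' (Eventually.of_forall fun n => ae_of_all _ fun ω => rfl)
    (ae_of_all _ fun ω => by simp)

/-- **THE TWO-CODE AGREEMENT TEST HAS POWER TENDING TO ONE AGAINST ANY FIXED DISCREPANCY.**  Two
independent codes print a.e.-measurable columns `Sₙ^X` with `√n(Sₙ^X − a_X) ⇒ Z_X` and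
non-negative squared standard errors `V̂ₙ^X` with `n·V̂ₙ^A → s_A > 0`, `n·V̂ₙ^B → s_B` in
probability; code `B` is read along any `mₙ → ∞`.  If `a_A ≠ a_B` then for every `z`:
`(P_A ⊗ P_B)(|(Sₙ^A − S_{mₙ}^B)/√(V̂ₙ^A + V̂_{mₙ}^B)| ≤ z) → 0`. [ours] -/
theorem twoSample_agreement_power {SA VA : ℕ → ΩA → ℝ} {SB VB : ℕ → ΩB → ℝ}
    {aA aB sA sB : ℝ} {ZA ZB : Ω' → ℝ} (hab : aA ≠ aB) (hsA : 0 < sA)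
    (hVA0 : ∀ n ω, 0 ≤ VA n ω) (hVB0 : ∀ n ω, 0 ≤ VB n ω)
    (hcltA : TendstoInDistribution (fun (n : ℕ) ω => Real.sqrt n * (SA n ω - aA)) atTop ZA
      (fun _ => PA) P')
    (hcltB : TendstoInDistribution (fun (n : ℕ) ω => Real.sqrt n * (SB n ω - aB)) atTop ZB
      (fun _ => PB) P')
    (hVA : TendstoInMeasure PA (fun (n : ℕ) ω => (n : ℝ) * VA n ω) atTop fun _ => sA)
    (hVB : TendstoInMeasure PB (fun (n : ℕ) ω => (n : ℝ) * VB n ω) atTop fun _ => sB)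
    {m : ℕ → ℕ} (hm : Tendsto m atTop atTop) (z : ℝ) :
    Tendsto (fun n => (PA.prod PB).real {ω : ΩA × ΩB |
        |(SA n ω.1 - SB (m n) ω.2) / Real.sqrt (VA n ω.1 + VB (m n) ω.2)| ≤ z}) atTop (𝓝 0) := by
  -- the difference of the columns tends to `Δ = a_A − a_B` in probability on the product space
  have hSA : TendstoInMeasure PA SA atTop fun _ => aA :=
    tendstoInMeasure_of_tendstoInDistribution_scaled
      (Real.tendsto_sqrt_atTop.comp tendsto_natCast_atTop_atTop) hcltA
  have hSB : TendstoInMeasure PB SB atTop fun _ => aB :=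
    tendstoInMeasure_of_tendstoInDistribution_scaled
      (Real.tendsto_sqrt_atTop.comp tendsto_natCast_atTop_atTop) hcltB
  have hSA' := tendstoInMeasure_comp_fst (PB := PB) hSA
  have hSB' := tendstoInMeasure_comp_snd (PA := PA) (tendstoInMeasure_comp_tendsto hSB hm)
  have hD : TendstoInMeasure (PA.prod PB) (fun n (ω : ΩA × ΩB) => SA n ω.1 - SB (m n) ω.2)
      atTop fun _ => aA - aB := by
    have hφ : ContinuousAt (fun p : ℝ × ℝ => p.1 - p.2) (aA, aB) := by fun_prop
    have h := tendstoInMeasure_comp_continuousAt_normed (tendstoInMeasure_prodMk hSA' hSB') hφ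
    exact h.congr' (Eventually.of_forall fun n => ae_of_all _ fun ω => rfl)
      (ae_of_all _ fun ω => rfl)
  -- the pooled squared standard error tends to `0` in probability
  have hEA := tendstoInMeasure_comp_fst (PB := PB) (tendstoInMeasure_errorBar_zero hVA)
  have hEB := tendstoInMeasure_comp_snd (PA := PA)
    (tendstoInMeasure_comp_tendsto (tendstoInMeasure_errorBar_zero hVB) hm)
  have hE : TendstoInMeasure (PA.prod PB) (fun (n : ℕ) (ω : ΩA × ΩB) =>
      ((n : ℝ) * VA n ω.1) * (n : ℝ)⁻¹ + (((m n : ℕ) : ℝ) * VB (m n) ω.2) * ((m n : ℕ) : ℝ)⁻¹)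
      atTop fun _ => (0 : ℝ) := by
    have hφ : ContinuousAt (fun p : ℝ × ℝ => p.1 + p.2) ((0 : ℝ), (0 : ℝ)) := by fun_prop
    have h := tendstoInMeasure_comp_continuousAt_normed (tendstoInMeasure_prodMk hEA hEB) hφ
    exact h.congr' (Eventually.of_forall fun n => ae_of_all _ fun ω => rfl)
      (ae_of_all _ fun ω => by simp)
  -- the mean weight event: `n·V̂ₙ^A` stays away from `0`
  have hNA := tendstoInMeasure_comp_fst (PB := PB) hVA
  -- three small events
  set Δ : ℝ := aA - aB with hΔ
  have hΔ0 : 0 < |Δ| := abs_pos.2 (sub_ne_zero.2 hab)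
  set c : ℝ := (|Δ| / (4 * (|z| + 1))) ^ 2 with hc
  have hc0 : 0 < c := by positivity
  rw [tendstoInMeasure_iff_norm] at hD hE hNA
  have h1 := hD (|Δ| / 2) (by positivity)
  have h2 := hE c hc0
  have h3 := hNA sA hsA
  have hsum := (h1.add h2).add h3
  rw [add_zero, add_zero] at hsum
  have hle : ∀ n, 1 ≤ n → 1 ≤ m n → (PA.prod PB) {ω : ΩA × ΩB |
      |(SA n ω.1 - SB (m n) ω.2) / Real.sqrt (VA n ω.1 + VB (m n) ω.2)| ≤ z}
      ≤ (PA.prod PB) {ω : ΩA × ΩB | |Δ| / 2 ≤ ‖SA n ω.1 - SB (m n) ω.2 - (aA - aB)‖}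
        + (PA.prod PB) {ω : ΩA × ΩB | c ≤ ‖((n : ℝ) * VA n ω.1) * (n : ℝ)⁻¹
          + (((m n : ℕ) : ℝ) * VB (m n) ω.2) * ((m n : ℕ) : ℝ)⁻¹ - 0‖}
        + (PA.prod PB) {ω : ΩA × ΩB | sA ≤ ‖(n : ℝ) * VA n ω.1 - sA‖} := by
    intro n hn hmn
    have hn0 : (n : ℝ) ≠ 0 := by exact_mod_cast (by omega : n ≠ 0)
    have hm0 : ((m n : ℕ) : ℝ) ≠ 0 := by exact_mod_cast (by omega : m n ≠ 0)
    refine (measure_mono fun ω hω => ?_).trans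
      ((measure_union_le _ _).trans (add_le_add (measure_union_le _ _) le_rfl))
    simp only [Set.mem_setOf_eq, Set.mem_union] at hω ⊢
    by_contra hnot
    simp only [not_or, not_le] at hnot
    obtain ⟨⟨hD', hE'⟩, hN'⟩ := hnot
    -- unpack: `|D − Δ| < |Δ|/2`, `E < c`, `V̂^A > 0`
    have hEeq : ((n : ℝ) * VA n ω.1) * (n : ℝ)⁻¹ + (((m n : ℕ) : ℝ) * VB (m n) ω.2)
        * ((m n : ℕ) : ℝ)⁻¹ = VA n ω.1 + VB (m n) ω.2 := by
      field_simp
    rw [hEeq, sub_zero, Real.norm_eq_abs,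
      abs_of_nonneg (add_nonneg (hVA0 _ _) (hVB0 _ _))] at hE'
    rw [Real.norm_eq_abs] at hD' hN'
    have hVApos : 0 < VA n ω.1 := by
      by_contra hle0
      push Not at hle0
      have hV0 : VA n ω.1 = 0 := le_antisymm hle0 (hVA0 _ _)
      rw [hV0, mul_zero, zero_sub, abs_neg, abs_of_pos hsA] at hN'
      exact lt_irrefl _ hN'
    have hEpos : 0 < VA n ω.1 + VB (m n) ω.2 := add_pos_of_pos_of_nonneg hVApos (hVB0 _ _)
    have hsqrt : 0 < Real.sqrt (VA n ω.1 + VB (m n) ω.2) := Real.sqrt_pos.2 hEpos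
    -- `|D| > |Δ|/2`
    have hDbig : |Δ| / 2 < |SA n ω.1 - SB (m n) ω.2| := by
      have h1 := abs_sub_abs_le_abs_sub Δ (SA n ω.1 - SB (m n) ω.2)
      have h2 : |Δ - (SA n ω.1 - SB (m n) ω.2)| = |SA n ω.1 - SB (m n) ω.2 - (aA - aB)| := by
        rw [hΔ, abs_sub_comm]
      rw [h2] at h1
      linarith
    -- `z·√E < |Δ|/4`
    have hsqrt_lt : Real.sqrt (VA n ω.1 + VB (m n) ω.2) < |Δ| / (4 * (|z| + 1)) := by
      calc Real.sqrt (VA n ω.1 + VB (m n) ω.2) < Real.sqrt c := Real.sqrt_lt_sqrt hEpos.le hE'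
        _ = |Δ| / (4 * (|z| + 1)) := by rw [hc, Real.sqrt_sq (by positivity)]
    have hzE : z * Real.sqrt (VA n ω.1 + VB (m n) ω.2) < |Δ| / 2 := by
      have h1' : z * Real.sqrt (VA n ω.1 + VB (m n) ω.2)
          ≤ |z| * Real.sqrt (VA n ω.1 + VB (m n) ω.2) :=
        mul_le_mul_of_nonneg_right (le_abs_self z) hsqrt.le
      have h2' : |z| * Real.sqrt (VA n ω.1 + VB (m n) ω.2) ≤ |z| * (|Δ| / (4 * (|z| + 1))) :=
        mul_le_mul_of_nonneg_left hsqrt_lt.le (abs_nonneg z)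
      have h3' : |z| * (|Δ| / (4 * (|z| + 1))) < |Δ| / 2 := by
        rw [lt_div_iff₀ (by norm_num : (0 : ℝ) < 2)]
        have hz1 : 0 < |z| + 1 := by positivity
        have : |z| * (|Δ| / (4 * (|z| + 1))) * 2 = |Δ| * (|z| / (2 * (|z| + 1))) := by
          field_simp
          ring
        rw [this]
        have hfrac : |z| / (2 * (|z| + 1)) < 1 := by
          rw [div_lt_one (by positivity)]
          linarith [abs_nonneg z]
        nlinarith
      linarith
    -- contradiction with `|T| ≤ z`
    rw [abs_div, abs_of_pos hsqrt, div_le_iff₀ hsqrt] at hω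
    linarith
  have hsum' := (ENNReal.tendsto_toReal ENNReal.zero_ne_top).comp hsum
  rw [ENNReal.toReal_zero] at hsum'
  refine tendsto_of_tendsto_of_tendsto_of_le_of_le' tendsto_const_nhds hsum'
    (Eventually.of_forall fun n => ?_) ?_
  · exact measureReal_nonneg
  · filter_upwards [eventually_ge_atTop 1, hm.eventually (eventually_ge_atTop 1)] with n hn hmn
    rw [Function.comp_apply, measureReal_def]
    exact ENNReal.toReal_mono (ENNReal.add_ne_top.2 ⟨ENNReal.add_ne_top.2
      ⟨measure_ne_top _ _, measure_ne_top _ _⟩, measure_ne_top _ _⟩) (hle n hn hmn)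

end Power

end Summit.Ventures.LatticeQCDFlow.Scoring.CardConsistency

end
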